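import Summits.BirchSwinnertonDyer.BirchSwinnertonDyer.Theorems.SemiOrdinaryEisensteinDescentWildKolyvaginUpperAtThreeTowerFreeJetchevMaxModThree
import Literature.NumberTheory.EllipticCurves.ModularParametrizationDegreeProofs
import HarnessLib

/-!
# Route `SemiOrdinaryEisensteinDescent`, crux of record Ko′ `WildKolyvaginUpperAtThreeTowerFree` (stmt-BirchSwinnertonDyer-24696):
# the MANIN input reduced to ONE arithmetic statement — «the `3`-primitive part of the Manin constant is admissible»
# (= `3 ∤ c°`, the `3`-part of Manin's conjecture) — the analytic/geometric half of `ManinScaling₃` DISCHARGED by the tree's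
# PROVED degree theorem `exists_modularDegree_holds` (width seat `bsd-wall-soed-p2-w2` g5; `--supports stmt-…-24696`, helper)

WHY. After p600275 / p606426 the SOED Ko′-column reads: Ko′ BY NAME ⟸ {CT, 3.7 (2), E0, PT} + J′♭ on frames with ≥ 2 Tamagawa
`3`-carriers + `ManinScaling₃`, where `ManinScaling₃` (lead g2's MANIN-SHADOW memo, p583762) says «every parametrisation datum
`Dt` of a curve of the cell is an integer multiple `c = k·c′` of a datum `Dt′` with the same newform and uniformisation and
`3 ∤ c′`». That statement mixes two things: (a) ARITHMETIC — the `3`-primitive part `c₁ = c/3^{v₃ c}` of the constant is still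
ADMISSIBLE (`c₁ Λ_f ⊆ Λ_W`), i.e. `3 ∤ c°` for the generator `c°` of the admissible group `{c : c Λ_f ⊆ Λ_W} = c°ℤ` — the
`3`-part of Manin's conjecture for the class (lead g2 §1(c): `v₃ c° = v₃ c_opt`); (b) GEOMETRY — the map
`Γ₀(N)τ ↦ uniformize(c₁ · 2πi ∫ f)` has a degree (field `deg_spec` of the structure). The memo called (b) «the one non-formal
step»; but (b) is a THEOREM of the tree: `exists_modularDegree_holds` (`Literature/…/ModularParametrizationDegreeProofs`, the
degree of `X₀(N) → ℂ/Λ` for ANY non-zero admissible constant, proved on `ℍ` from reduction theory, `q`-expansions at the cusps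
and the inverse function theorem) transported along `ℂ/Λ_E ≃ E(ℂ)` (`finite_setOf_card_fiberOrbits_ne_iff`) exactly as in
`nonempty_modularParametrizationData_of_isNewformOf`. So the Manin input of Ko′ is (a) ALONE.

WHAT IS PROVED (no definition, no named fact, no `sorry`; CONDITIONAL theorems, nothing asserted about any curve):
* `exists_datum_of_admissible` — for every datum `Dt` and every non-zero integer `c₁` with `c₁ Λ_f ⊆ Λ_W` there is a datum
  `Dt′` with `Dt′.f = Dt.f`, `Dt′.uniformize = Dt.uniformize`, `Dt′.c = c₁` (degree by `exists_modularDegree_holds`).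
* `maninScaling_of_primitiveAdmissible` — `ManinScaling₃` (displayed, as in p600275/p606426) ⟸ `hPrim`: «for every datum of a
  curve of the cell, `Dt.c = k · c₁` with `3 ∤ c₁` and `c₁ Λ_f ⊆ Λ_W`» (displayed; ⟺ `3 ∤ c°`; off print at `27 ∣ N`).
* `wildKolyvaginUpperAtThreeTowerFree_of_flatMultiCarrier_of_primitiveAdmissible_of_fourPrimitives` — **Ko′ BY NAME ⟸
  {CT, 3.7(2), E0, PT} + `hPrim` + J′♭ on frames with ≥ 2 TAMAGAWA `3`-carriers** (∘ p606426 §3); and the J′ version.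
HONEST FRAMING: `hPrim` is the `3`-part of Manin's conjecture at `27 ∣ N` (Česnavičius–Neururer–Saha need `3 ∤ deg φ₀`; `3 ∣ deg φ₀`
on all 3 894 classes of the row; `c_opt = 1` there only by Cremona's finite verification); `hJmF` is open research (Büyükboduk
2009 §4.2 Q1 at `3`); the four primitives are Literature named facts. Ko′, J′, Manin's conjecture and BSD stay open — BSD is not
proved by this file.

References: [EdixhovenManin1991] §1; [AgasheRibetStein2006] Thm. 2.7; [CesnaviciusNeururerSaha2023] Thm. 1.2; [Cremona ANTS VII
2006] §3.8; [FarkasKra1992] Prop. I.1.6; [DiamondShurman2005] §3.1, §6.6; [Jetchev2008] Rem. 1.2, Conj. 1.3; [McCallumLMS1991]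
§5 Cor. 5.6.
-/

set_option autoImplicit false
set_option linter.dupNamespace false -- `Summit.BirchSwinnertonDyer.BirchSwinnertonDyer.…` is the tree's layout (D-0017)

noncomputable section

open scoped Classical

namespace Summit.BirchSwinnertonDyer.BirchSwinnertonDyer.Theorems.WildKolyvaginUpperAtThreeTowerFreeManinPrimitive

open WeierstrassCurve NumberField
  Literature.NumberTheory.EllipticCurves
  Literature.NumberTheory.EllipticCurves.ModularForms
  Literature.NumberTheory.GaloisCohomology
  Summit.BirchSwinnertonDyer.Rank1Residual
  Summit.BirchSwinnertonDyer.Rank1Residual.Additive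
  Summit.BirchSwinnertonDyer.Rank1Residual.X11b.Three
  Summit.BirchSwinnertonDyer.BirchSwinnertonDyer.Theses.SemiOrdinaryEisensteinDescent
  Summit.BirchSwinnertonDyer.BirchSwinnertonDyer.Theorems.WildKolyvaginUpperAtThreeTowerFreeJetchevMaxModThree
open Literature.NumberTheory.EllipticCurves.GrossLMS1991 (prop37_2_frobeniusCongruence)

/-! ## §1 A datum for every non-zero admissible constant (the geometric half, PROVED) -/

/-- **Every non-zero admissible constant carries a datum with the same newform and uniformisation.** For a modular
parametrisation datum `Dt` of `W` at level `N` and an integer `c₁ ≠ 0` with `c₁ Λ_f ⊆ Λ_W` (`Λ_f = periodLattice Dt.f`,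
`Λ_W = Dt.L.lattice`), there is a datum `Dt′` with `Dt′.f = Dt.f`, `Dt′.uniformize = Dt.uniformize` and `Dt′.c = c₁`: the
degree clause is the tree's PROVED `exists_modularDegree_holds` (degree of `Γ₀(N)τ ↦ c₁·2πi∫f (mod Λ_W)`) transported along the
uniformisation `ℂ/Λ_W ≃ E(ℂ)` (`finite_setOf_card_fiberOrbits_ne_iff`). [cite: FarkasKra1992, Prop. I.1.6]
[cite: DiamondShurman2005, §3.1 (p. 65) and §6.6] [cite: EdixhovenManin1991, §1] -/
theorem exists_datum_of_admissible {W : WeierstrassCurve ℚ} {N : ℕ} [NeZero N]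
    (Dt : ModularParametrizationData W N) {c₁ : ℤ} (hc₁ : c₁ ≠ 0)
    (hadm : ∀ z ∈ periodLattice Dt.f, (c₁ : ℂ) * z ∈ Dt.L.lattice) :
    ∃ Dt' : ModularParametrizationData W N, Dt'.f = Dt.f ∧ Dt'.uniformize = Dt.uniformize ∧ Dt'.c = c₁ := by
  obtain ⟨d, hd, hfin⟩ := exists_modularDegree_holds Dt.isNewformOf.1.ne_zero (L := Dt.L) (c := (c₁ : ℂ))
    (Int.cast_ne_zero.mpr hc₁) hadm
  -- transport the exceptional set along `ℂ/Λ_W ≃ E(ℂ)` (the datum's own uniformisation)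
  have hker' : Dt.L.lattice.toAddSubgroup = Dt.uniformize.ker :=
    SetLike.coe_injective (by rw [Submodule.coe_toAddSubgroup, Dt.ker_uniformize])
  let e : ℂ ⧸ Dt.L.lattice.toAddSubgroup ≃+ (W.baseChange ℂ).toAffine.Point :=
    QuotientAddGroup.liftEquiv Dt.L.lattice.toAddSubgroup Dt.uniformize_surjective hker'
  have he : ∀ x : ℂ, e.toEquiv (x : ℂ ⧸ Dt.L.lattice.toAddSubgroup) = Dt.uniformize x := fun _ ↦ rfl
  have key := (finite_setOf_card_fiberOrbits_ne_iff e.toEquiv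
    (fun τ : UpperHalfPlane ↦
      (((c₁ : ℂ) * eichlerIntegral Dt.f τ : ℂ) : ℂ ⧸ Dt.L.lattice.toAddSubgroup)) d).mpr hfin
  simp only [he] at key
  exact ⟨{ f := Dt.f
           isNewformOf := Dt.isNewformOf
           L := Dt.L
           isNeronLattice := Dt.isNeronLattice
           uniformize := Dt.uniformize
           ker_uniformize := Dt.ker_uniformize
           uniformize_surjective := Dt.uniformize_surjective
           uniformize_spec := Dt.uniformize_spec
           c := c₁
           smul_periodLattice_le := hadm
           deg := d
           deg_pos := hd
           deg_spec := key }, rfl, rfl, rfl⟩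

/-! ## §2 `ManinScaling₃` ⟸ «the `3`-primitive part of the constant is admissible» -/

/-- **`ManinScaling₃` from the arithmetic statement alone.** `hPrim`: for every datum `Dt` of a curve of the cell,
`Dt.c = k · c₁` with `3 ∤ c₁` and `c₁` ADMISSIBLE (`c₁ Λ_f ⊆ Λ_W`) — equivalently `3 ∤ c°` for the generator `c°` of the admissible
group `{c : c Λ_f ⊆ Λ_W}` (the `3`-part of Manin's conjecture for the class; displayed, NOT proved). Conclusion: the displayed
`ManinScaling₃` hypothesis of p583762 / p600275 / p606426 (`∃ Dt′ k, Dt′.f = Dt.f ∧ Dt′.uniformize = Dt.uniformize ∧ Dt.c = k * Dt′.c ∧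
¬ 3 ∣ Dt′.c`), by §1. [cite: EdixhovenManin1991, §1] [cite: AgasheRibetStein2006, Thm. 2.7] [cite: CesnaviciusNeururerSaha2023, Thm. 1.2] -/
theorem maninScaling_of_primitiveAdmissible
    (hPrim : ∀ (W : WeierstrassCurve ℚ) [W.IsElliptic] [W.IsGloballyMinimal] (N : ℕ) [NeZero N],
      ClassO6 W 3 → W.HasSurjectiveModNGaloisRep 3 → W.analyticRank = 1 → W.conductorNorm ℤ = N →
      ∀ (Dt : ModularParametrizationData W N), ∃ (c₁ k : ℤ), Dt.c = k * c₁ ∧ ¬ (3 : ℤ) ∣ c₁ ∧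
        ∀ z ∈ periodLattice Dt.f, (c₁ : ℂ) * z ∈ Dt.L.lattice) :
    ∀ (W : WeierstrassCurve ℚ) [W.IsElliptic] [W.IsGloballyMinimal] (N : ℕ) [NeZero N],
      ClassO6 W 3 → W.HasSurjectiveModNGaloisRep 3 → W.analyticRank = 1 → W.conductorNorm ℤ = N →
      ∀ (Dt : ModularParametrizationData W N), ∃ (Dt' : ModularParametrizationData W N) (k : ℤ),
        Dt'.f = Dt.f ∧ Dt'.uniformize = Dt.uniformize ∧ Dt.c = k * Dt'.c ∧ ¬ (3 : ℤ) ∣ Dt'.c := by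
  intro W _ _ N _ hO6 hsurj hr hN Dt
  obtain ⟨c₁, k, hck, h3, hadm⟩ := hPrim W N hO6 hsurj hr hN Dt
  have hc₁ : c₁ ≠ 0 := by rintro rfl; exact h3 (dvd_zero 3)
  obtain ⟨Dt', hf, hu, hc⟩ := exists_datum_of_admissible Dt hc₁ hadm
  exact ⟨Dt', k, hf, hu, by rw [hc, hck], by rw [hc]; exact h3⟩

/-! ## §3 Ko′ and J′ BY NAME with the Manin input in arithmetic form -/

/-- **J′ `WildSigmaDivisibilityAtThreeTowerFree` (stmt-24702) BY NAME ⟸ (PT), (F1), (3.7) + `hPrim` + J′♭ on frames with ≥ 2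
Tamagawa `3`-carriers** (§2 ∘ p606426 §3). CONDITIONAL; J′ and BSD stay open. [cite: Jetchev2008, Rem. 1.2 and Conj. 1.3 (p. 812)]
[cite: CesnaviciusNeururerSaha2023, Thm. 1.2] -/
theorem wildSigmaDivisibilityAtThreeTowerFree_of_flatMultiCarrier_of_primitiveAdmissible_of_threePrintFacts
    (hPT : ∀ (K : Type) [Field K] [NumberField K], poitouTate_selmerStructure_duality_conj K)
    (hF1 : Gross1991_heegnerPoint_sub_ratTorsion_mem_E0) (h372 : prop37_2_frobeniusCongruence)
    (hPrim : ∀ (W : WeierstrassCurve ℚ) [W.IsElliptic] [W.IsGloballyMinimal] (N : ℕ) [NeZero N],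
      ClassO6 W 3 → W.HasSurjectiveModNGaloisRep 3 → W.analyticRank = 1 → W.conductorNorm ℤ = N →
      ∀ (Dt : ModularParametrizationData W N), ∃ (c₁ k : ℤ), Dt.c = k * c₁ ∧ ¬ (3 : ℤ) ∣ c₁ ∧
        ∀ z ∈ periodLattice Dt.f, (c₁ : ℂ) * z ∈ Dt.L.lattice)
    (hJmF : ∀ (W : WeierstrassCurve ℚ) [W.IsElliptic] [W.IsGloballyMinimal] (N : ℕ) [NeZero N] (K : Type)
      [Field K] [NumberField K] (Dt : ModularParametrizationData W N)
      (H : HeegnerDatum N (NumberField.discr K)) (ι : K →+* ℂ) (P : (W.baseChange K).toAffine.Point),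
      ClassO6 W 3 → W.HasSurjectiveModNGaloisRep 3 → W.analyticRank = 1 → W.conductorNorm ℤ = N →
      IsImaginaryQuadratic K → SatisfiesHeegnerHypothesis N K →
      (W.quadraticTwist (NumberField.discr K : ℚ)).entireLFunction 1 ≠ 0 →
      WeierstrassCurve.Affine.Point.map ι.toRatAlgHom P = heegnerPointComplex Dt H →
      ¬ IsOfFinAddOrder P → Odd (NumberField.discr K) → NumberField.discr K ≠ -3 →
      ¬ (3 : ℤ) ∣ Dt.c →
      (∀ (q : ℕ) [Fact q.Prime], q ∣ N →
        padicValNat 3 ((W.baseChange ℚ_[q]).localTamagawaNumber ℤ_[q]) <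
          padicValNat 3 W.tamagawaProduct + padicValNat 3 Dt.c.natAbs) →
      ∀ (s' : ℕ), s' ≤ padicValNat 3 W.tamagawaProduct + padicValNat 3 Dt.c.natAbs →
        ∀ (n : ℕ) (d : KolyvaginHeegnerData Dt H.β ι n), Squarefree n →
          (∀ ℓ ∈ n.primeFactors, Zhang2014.IsKolyvaginPrime N W K 3 ℓ ∧
            s' ≤ Zhang2014.kolyvaginIndex W 3 ℓ) → Koly.PDiv d 3 s') :
    WildSigmaDivisibilityAtThreeTowerFree :=
  wildSigmaDivisibilityAtThreeTowerFree_of_flatMultiCarrier_of_maninScaling_of_threePrintFacts hPT hF1 h372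
    (maninScaling_of_primitiveAdmissible hPrim) hJmF

/-- **Crux of record Ko′ `WildKolyvaginUpperAtThreeTowerFree` (stmt-24696) BY NAME ⟸ {CT, 3.7 (2), E0, PT} + `hPrim` (the `3`-part
of Manin's conjecture in admissible-constant form) + J′♭ on frames with ≥ 2 TAMAGAWA `3`-carriers** — no tower, no geometric
side-condition. So the SOED Ko′-column's inputs beyond the four named print statements are exactly TWO displayed research
statements: `hJmF` (Büyükboduk 2009 §4.2 Q1 at `3`, census T17 residue) and `hPrim` (`3 ∤ c°` at `27 ∣ N`). CONDITIONAL on all six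
displayed hypotheses; Ko′, J′, Manin's conjecture and BSD stay open. [cite: McCallumLMS1991, §5 Cor. 5.6 (p. 310)]
[cite: Jetchev2008, Thm. 1.4 and Conj. 1.3 (p. 812)] [cite: Buyukboduk2009TamagawaDefect, §4.2 Question 1]
[cite: CesnaviciusNeururerSaha2023, Thm. 1.2] [cite: EdixhovenManin1991, §1] -/
theorem wildKolyvaginUpperAtThreeTowerFree_of_flatMultiCarrier_of_primitiveAdmissible_of_fourPrimitives
    (hCT : ∀ (K : Type) [Field K] [NumberField K], casselsTate_levelInputs K)
    (h372 : prop37_2_frobeniusCongruence) (hE0 : Gross1991_heegnerPoint_sub_ratTorsion_mem_E0)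
    (hPT : ∀ (K : Type) [Field K] [NumberField K], poitouTate_selmerStructure_duality_conj K)
    (hPrim : ∀ (W : WeierstrassCurve ℚ) [W.IsElliptic] [W.IsGloballyMinimal] (N : ℕ) [NeZero N],
      ClassO6 W 3 → W.HasSurjectiveModNGaloisRep 3 → W.analyticRank = 1 → W.conductorNorm ℤ = N →
      ∀ (Dt : ModularParametrizationData W N), ∃ (c₁ k : ℤ), Dt.c = k * c₁ ∧ ¬ (3 : ℤ) ∣ c₁ ∧
        ∀ z ∈ periodLattice Dt.f, (c₁ : ℂ) * z ∈ Dt.L.lattice)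
    (hJmF : ∀ (W : WeierstrassCurve ℚ) [W.IsElliptic] [W.IsGloballyMinimal] (N : ℕ) [NeZero N] (K : Type)
      [Field K] [NumberField K] (Dt : ModularParametrizationData W N)
      (H : HeegnerDatum N (NumberField.discr K)) (ι : K →+* ℂ) (P : (W.baseChange K).toAffine.Point),
      ClassO6 W 3 → W.HasSurjectiveModNGaloisRep 3 → W.analyticRank = 1 → W.conductorNorm ℤ = N →
      IsImaginaryQuadratic K → SatisfiesHeegnerHypothesis N K →
      (W.quadraticTwist (NumberField.discr K : ℚ)).entireLFunction 1 ≠ 0 →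
      WeierstrassCurve.Affine.Point.map ι.toRatAlgHom P = heegnerPointComplex Dt H →
      ¬ IsOfFinAddOrder P → Odd (NumberField.discr K) → NumberField.discr K ≠ -3 →
      ¬ (3 : ℤ) ∣ Dt.c →
      (∀ (q : ℕ) [Fact q.Prime], q ∣ N →
        padicValNat 3 ((W.baseChange ℚ_[q]).localTamagawaNumber ℤ_[q]) <
          padicValNat 3 W.tamagawaProduct + padicValNat 3 Dt.c.natAbs) →
      ∀ (s' : ℕ), s' ≤ padicValNat 3 W.tamagawaProduct + padicValNat 3 Dt.c.natAbs →
        ∀ (n : ℕ) (d : KolyvaginHeegnerData Dt H.β ι n), Squarefree n →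
          (∀ ℓ ∈ n.primeFactors, Zhang2014.IsKolyvaginPrime N W K 3 ℓ ∧
            s' ≤ Zhang2014.kolyvaginIndex W 3 ℓ) → Koly.PDiv d 3 s') :
    WildKolyvaginUpperAtThreeTowerFree :=
  wildKolyvaginUpperAtThreeTowerFree_of_flatMultiCarrier_of_maninScaling_of_fourPrimitives hCT h372 hE0 hPT
    (maninScaling_of_primitiveAdmissible hPrim) hJmF

/-! ## §4 (appended) The Manin input in AKR currency: ONE `3`-good datum per curve suffices -/

/-- **`hPrim` ⟸ «every curve of the cell has SOME datum with `3 ∤ c`»** (the currency of route AdditiveKolyvaginRoad's Manin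
frames, `¬ p ∣ Dt.c`). For two data `Dt`, `Dt₀` of the same curve at the same level the newforms coincide (`IsNewformOf.unique`,
`q`-expansions) and the Néron lattices coincide (`IsNeronLatticeOf.lattice_eq`, uniformization uniqueness — both PROVED in the
tree), so the admissible constants `{c : c Λ_f ⊆ Λ_W}` form ONE subgroup of `ℤ` for the curve; `c₁ := gcd(Dt.c, Dt₀.c)` is
admissible (Bézout), divides `Dt.c`, and is prime to `3` because it divides `Dt₀.c`. [cite: EdixhovenManin1991, §1]
[cite: SilvermanAEC2009, Thm. VI.5.1 (uniqueness)] -/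
theorem primitiveAdmissible_of_maninGood
    (hGood : ∀ (W : WeierstrassCurve ℚ) [W.IsElliptic] [W.IsGloballyMinimal] (N : ℕ) [NeZero N],
      ClassO6 W 3 → W.HasSurjectiveModNGaloisRep 3 → W.analyticRank = 1 → W.conductorNorm ℤ = N →
      Nonempty (ModularParametrizationData W N) →
      ∃ Dt₀ : ModularParametrizationData W N, ¬ (3 : ℤ) ∣ Dt₀.c) :
    ∀ (W : WeierstrassCurve ℚ) [W.IsElliptic] [W.IsGloballyMinimal] (N : ℕ) [NeZero N],
      ClassO6 W 3 → W.HasSurjectiveModNGaloisRep 3 → W.analyticRank = 1 → W.conductorNorm ℤ = N →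
      ∀ (Dt : ModularParametrizationData W N), ∃ (c₁ k : ℤ), Dt.c = k * c₁ ∧ ¬ (3 : ℤ) ∣ c₁ ∧
        ∀ z ∈ periodLattice Dt.f, (c₁ : ℂ) * z ∈ Dt.L.lattice := by
  intro W _ _ N _ hO6 hsurj hr hN Dt
  obtain ⟨Dt₀, h3⟩ := hGood W N hO6 hsurj hr hN ⟨Dt⟩
  have hf : Dt₀.f = Dt.f := Dt₀.isNewformOf.unique Dt.isNewformOf
  have hL : Dt₀.L.lattice = Dt.L.lattice := Dt₀.isNeronLattice.lattice_eq Dt.isNeronLattice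
  refine ⟨(Int.gcd Dt.c Dt₀.c : ℤ), Dt.c / (Int.gcd Dt.c Dt₀.c : ℤ), ?_, ?_, ?_⟩
  · exact (Int.ediv_mul_cancel (Int.gcd_dvd_left Dt.c Dt₀.c)).symm
  · exact fun h ↦ h3 (h.trans (Int.gcd_dvd_right Dt.c Dt₀.c))
  · intro z hz
    have h1 : (Dt.c : ℂ) * z ∈ Dt.L.lattice := Dt.smul_periodLattice_le z hz
    have h2 : (Dt₀.c : ℂ) * z ∈ Dt.L.lattice := hL ▸ Dt₀.smul_periodLattice_le z (hf ▸ hz)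
    have hB : ((Int.gcd Dt.c Dt₀.c : ℤ) : ℂ) * z =
        (Dt.c.gcdA Dt₀.c : ℂ) * ((Dt.c : ℂ) * z) + (Dt.c.gcdB Dt₀.c : ℂ) * ((Dt₀.c : ℂ) * z) := by
      rw [Int.gcd_eq_gcd_ab Dt.c Dt₀.c]; push_cast; ring
    have hmul : ∀ (a : ℤ) {x : ℂ}, x ∈ Dt.L.lattice → (a : ℂ) * x ∈ Dt.L.lattice := fun a x hx ↦ by
      rw [← zsmul_eq_mul]; exact Dt.L.lattice.smul_mem a hx
    rw [hB]
    exact Dt.L.lattice.add_mem (hmul _ h1) (hmul _ h2)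

/-- **Crux of record Ko′ BY NAME ⟸ {CT, 3.7 (2), E0, PT} + «one `3`-good datum per curve of the cell» + J′♭ on frames with ≥ 2
TAMAGAWA `3`-carriers** (§4 ∘ §3). The Manin input is now literally the `3`-part of Manin's conjecture in the currency of route
AdditiveKolyvaginRoad (`∃ Dt, ¬ 3 ∣ Dt.c`, given that a datum exists at all); the only other research input is `hJmF`
(Büyükboduk 2009 §4.2 Q1 at `3`). CONDITIONAL on all six displayed hypotheses; Ko′, J′, Manin's conjecture and BSD stay open.
[cite: McCallumLMS1991, §5 Cor. 5.6 (p. 310)] [cite: Jetchev2008, Thm. 1.4 and Conj. 1.3 (p. 812)]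
[cite: CesnaviciusNeururerSaha2023, Thm. 1.2] [cite: AgasheRibetStein2006, Thm. 2.7] -/
theorem wildKolyvaginUpperAtThreeTowerFree_of_flatMultiCarrier_of_maninGood_of_fourPrimitives
    (hCT : ∀ (K : Type) [Field K] [NumberField K], casselsTate_levelInputs K)
    (h372 : prop37_2_frobeniusCongruence) (hE0 : Gross1991_heegnerPoint_sub_ratTorsion_mem_E0)
    (hPT : ∀ (K : Type) [Field K] [NumberField K], poitouTate_selmerStructure_duality_conj K)
    (hGood : ∀ (W : WeierstrassCurve ℚ) [W.IsElliptic] [W.IsGloballyMinimal] (N : ℕ) [NeZero N],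
      ClassO6 W 3 → W.HasSurjectiveModNGaloisRep 3 → W.analyticRank = 1 → W.conductorNorm ℤ = N →
      Nonempty (ModularParametrizationData W N) →
      ∃ Dt₀ : ModularParametrizationData W N, ¬ (3 : ℤ) ∣ Dt₀.c)
    (hJmF : ∀ (W : WeierstrassCurve ℚ) [W.IsElliptic] [W.IsGloballyMinimal] (N : ℕ) [NeZero N] (K : Type)
      [Field K] [NumberField K] (Dt : ModularParametrizationData W N)
      (H : HeegnerDatum N (NumberField.discr K)) (ι : K →+* ℂ) (P : (W.baseChange K).toAffine.Point),
      ClassO6 W 3 → W.HasSurjectiveModNGaloisRep 3 → W.analyticRank = 1 → W.conductorNorm ℤ = N →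
      IsImaginaryQuadratic K → SatisfiesHeegnerHypothesis N K →
      (W.quadraticTwist (NumberField.discr K : ℚ)).entireLFunction 1 ≠ 0 →
      WeierstrassCurve.Affine.Point.map ι.toRatAlgHom P = heegnerPointComplex Dt H →
      ¬ IsOfFinAddOrder P → Odd (NumberField.discr K) → NumberField.discr K ≠ -3 →
      ¬ (3 : ℤ) ∣ Dt.c →
      (∀ (q : ℕ) [Fact q.Prime], q ∣ N →
        padicValNat 3 ((W.baseChange ℚ_[q]).localTamagawaNumber ℤ_[q]) <
          padicValNat 3 W.tamagawaProduct + padicValNat 3 Dt.c.natAbs) →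
      ∀ (s' : ℕ), s' ≤ padicValNat 3 W.tamagawaProduct + padicValNat 3 Dt.c.natAbs →
        ∀ (n : ℕ) (d : KolyvaginHeegnerData Dt H.β ι n), Squarefree n →
          (∀ ℓ ∈ n.primeFactors, Zhang2014.IsKolyvaginPrime N W K 3 ℓ ∧
            s' ≤ Zhang2014.kolyvaginIndex W 3 ℓ) → Koly.PDiv d 3 s') :
    WildKolyvaginUpperAtThreeTowerFree :=
  wildKolyvaginUpperAtThreeTowerFree_of_flatMultiCarrier_of_primitiveAdmissible_of_fourPrimitives hCT h372 hE0 hPT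
    (primitiveAdmissible_of_maninGood hGood) hJmF

end Summit.BirchSwinnertonDyer.BirchSwinnertonDyer.Theorems.WildKolyvaginUpperAtThreeTowerFreeManinPrimitive

end
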